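import Mathlib
import Literature.Probability.Percolation.PercolationProofs
import Literature.Probability.LatticeModels.ProdBernoulliIndependence
import Literature.Probability.LatticeModels.ProdBernoulliClusterLocality
import HarnessLib

/-!
# Crux `PercNearOneGluing.AdditiveGluing` (stmt-CriticalPhenomena-4576), line `sigma-recursion-lemma5-any-relay` — stub `stub_glueReach`

Helper file for the crux (lead prover-line-stmt-CriticalPhenomena-4576-0): proves exactly the
registered stub signature `stub_glueReach` (reachability after gluing a vertex set into an open
clique; pure walk combinatorics, no measure theory); lands with
`--supports stmt-CriticalPhenomena-4576`.

## Content

Fix `S ⊆ Fin n` and a bond configuration `ω`, and let `D_S = {e | (∀ x ∈ e, x ∈ S) ∧ ¬ e.IsDiag}`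
be the set of all non-loop pairs inside `S`, so that in `ω ∪ D_S` the set `S` is an open clique.
Then `x ↔ y` in `ω ∪ D_S` iff either `x ↔ y` in `ω`, or `x` reaches some `s ∈ S` in `ω` and some
`s' ∈ S` reaches `y` in `ω`.  (Folklore; this is the deterministic content of "gluing" a set of
vertices, cf. Kozma–Nitzan, arXiv:2401.12397, §3.2.)

## Proof

Phrased for two abstract simple graphs `G` (the open graph of `ω`) and `H` (the open graph of
`ω ∪ D_S`) on a vertex type `V` with a finset `S`:

* (⇒) `glueReach_walk_split`: if every `H`-edge is a `G`-edge or a pair inside `S`, then ONE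
  induction over an `H`-walk from `u` to `v` proves
  `G.Reachable u v ∨ ((∃ s ∈ S, G.Reachable u s) ∧ ∃ s ∈ S, G.Reachable s v)`: in the `cons`
  case `u ~ u₁`, a `G`-edge is prepended to whichever disjunct the induction hypothesis gives;
  a glued pair `u, u₁ ∈ S` makes `u` its own `S`-witness, and the `v`-side witness is either the
  one of the induction hypothesis or `u₁ ∈ S` itself.
* (⇐) `glueReach_of_split`: `G ≤ H` gives monotonicity of reachability
  (`SimpleGraph.Reachable.mono`), and two vertices of `S` are equal or `H`-adjacent.

The registered statement `stub_glueReach` instantiates `G := openGraph ω`,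
`H := openGraph (ω ∪ D_S)` and checks the linking facts with `openGraph_adj`,
`Sym2.forall_mem_pair` and `Sym2.mk_isDiag_iff`.
-/

namespace Summit.CriticalPhenomena.PercolationContinuityZ3.Theorems

open MeasureTheory Set
open Literature.Probability.LatticeModels (prodBernoulli)
open Literature.Probability.Percolation (BondConfig openConn openGraph)

noncomputable section
open Classical

section AbstractGluing

variable {V : Type*} {G H : SimpleGraph V} {S : Finset V}

/-- **Splitting a glued walk at its first glued pair.**  If every `H`-edge is a `G`-edge or a
pair inside `S`, then every `H`-walk from `u` to `v` yields either `G`-reachability of `v` from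
`u`, or an `S`-vertex `G`-reachable from `u` together with an `S`-vertex from which `v` is
`G`-reachable. [folklore] -/
theorem glueReach_walk_split
    (hHG : ∀ x y, H.Adj x y → G.Adj x y ∨ (x ∈ S ∧ y ∈ S)) {u v : V} (wk : H.Walk u v) :
    G.Reachable u v ∨ ((∃ s ∈ S, G.Reachable u s) ∧ (∃ s ∈ S, G.Reachable s v)) := by
  induction wk with
  | nil => exact Or.inl (SimpleGraph.Reachable.refl _)
  | @cons a b c hab wk ih =>
    rcases hHG a b hab with h | ⟨ha, hb⟩
    · rcases ih with h' | ⟨⟨s, hs, hbs⟩, h₂⟩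
      · exact Or.inl (h.reachable.trans h')
      · exact Or.inr ⟨⟨s, hs, h.reachable.trans hbs⟩, h₂⟩
    · rcases ih with h' | ⟨_, h₂⟩
      · exact Or.inr ⟨⟨a, ha, SimpleGraph.Reachable.refl _⟩, ⟨b, hb, h'⟩⟩
      · exact Or.inr ⟨⟨a, ha, SimpleGraph.Reachable.refl _⟩, h₂⟩

/-- **Gluing walks through the clique.**  If `G ≤ H` and distinct vertices of `S` are
`H`-adjacent, then `G`-reachability, or `G`-reachability of some `s ∈ S` from `u` together with
`G`-reachability of `v` from some `s' ∈ S`, gives `H`-reachability of `v` from `u`.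
[folklore] -/
theorem glueReach_of_split (hGH : G ≤ H)
    (hSS : ∀ x y, x ∈ S → y ∈ S → x ≠ y → H.Adj x y) {u v : V}
    (h : G.Reachable u v ∨ ((∃ s ∈ S, G.Reachable u s) ∧ (∃ s ∈ S, G.Reachable s v))) :
    H.Reachable u v := by
  rcases h with h | ⟨⟨s, hs, hus⟩, ⟨s', hs', hs'v⟩⟩
  · exact h.mono hGH
  · have hss' : H.Reachable s s' := by
      by_cases e : s = s'
      · subst e
        exact SimpleGraph.Reachable.refl _
      · exact (hSS s s' hs hs' e).reachable
    exact (hus.mono hGH).trans (hss'.trans (hs'v.mono hGH))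

end AbstractGluing

/-- Registered stub `stub_glueReach` of crux stmt-CriticalPhenomena-4576 (line
sigma-recursion-lemma5-any-relay): reachability in `ω` with the vertex set `S` glued into an
open clique; see the module docstring and the line skeleton for the informal statement and
sources. [folklore] -/
theorem stub_glueReach :
    ∀ (n : ℕ) (S : Finset (Fin n)) (ω : BondConfig (Fin n)) (x y : Fin n),
      ((ω ∪ {e | (∀ x ∈ e, x ∈ S) ∧ ¬ e.IsDiag}) ∈ openConn x y ↔
        (ω ∈ openConn x y ∨
          ((∃ s ∈ S, ω ∈ openConn x s) ∧ (∃ s ∈ S, ω ∈ openConn s y))))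
    := by
  intro n S ω x y
  have hHG : ∀ a b : Fin n, (openGraph (ω ∪ {e | (∀ x ∈ e, x ∈ S) ∧ ¬ e.IsDiag})).Adj a b →
      (openGraph ω).Adj a b ∨ (a ∈ S ∧ b ∈ S) := fun a b hab => by
    rw [Literature.Probability.Percolation.openGraph_adj] at hab
    obtain ⟨h | h, hne⟩ := hab
    · exact Or.inl ((Literature.Probability.Percolation.openGraph_adj ω a b).2 ⟨h, hne⟩)
    · exact Or.inr (Sym2.forall_mem_pair.1 h.1)
  have hGH : openGraph ω ≤ openGraph (ω ∪ {e | (∀ x ∈ e, x ∈ S) ∧ ¬ e.IsDiag}) := by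
    intro a b hab
    rw [Literature.Probability.Percolation.openGraph_adj] at hab ⊢
    exact ⟨Or.inl hab.1, hab.2⟩
  have hSS : ∀ a b : Fin n, a ∈ S → b ∈ S → a ≠ b →
      (openGraph (ω ∪ {e | (∀ x ∈ e, x ∈ S) ∧ ¬ e.IsDiag})).Adj a b := fun a b ha hb hne => by
    rw [Literature.Probability.Percolation.openGraph_adj]
    exact ⟨Or.inr ⟨Sym2.forall_mem_pair.2 ⟨ha, hb⟩, fun h => hne (Sym2.mk_isDiag_iff.1 h)⟩,
      hne⟩
  exact ⟨fun ⟨wk⟩ => glueReach_walk_split hHG wk, fun h => glueReach_of_split hGH hSS h⟩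

end

end Summit.CriticalPhenomena.PercolationContinuityZ3.Theorems
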